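import Literature.Analysis.SpecialFunctions.DigammaLogBound
import HarnessLib

/-!
# The digamma function on vertical lines: `ψ(a + iy) = log(1 + |y|) + O_a(1)`

Sibling of `DigammaGauss.lean` (`|Re ψ(w) − log ‖w‖| ≤ 1/(2‖w‖²) + π/(4|Im w|)` for `0 < Re w`,
`Im w ≠ 0`) and `DigammaLogBound.lean` (`|Im ψ(w)| ≤ |Im w|/‖w‖² + π/2`, the one-sided
`‖ψ(a + iy)‖ ≤ C_a + log(1 + |y|)` for `a > 0`). Here the TWO-SIDED asymptotic on every vertical
line off the poles:

* `exists_norm_digamma_sub_log_le_of_pos` — `a > 0`: `‖ψ(a + iy) − log(1 + |y|)‖ ≤ C_a` for all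
  real `y` (the two bounds above for `|y| ≥ 1`, `|y| ≤ ‖a+iy‖ ≤ a + |y|`, and continuity of `ψ` on
  the compact segment `|y| ≤ 1`);
* `exists_norm_digamma_sub_log_le` — any real `a ∉ {0, −1, −2, …}`, by the shift
  `ψ(w) = ψ(w + m) − ∑_{j<m} 1/(w + j)` (Mathlib's `Complex.digamma_apply_add_one`), each shift term
  being bounded by `1/|a + j|`.

This is Stirling's formula for `Γ'/Γ` in the weak form consumed by secondary terms of explicit
formulas on lines to the left of the critical strip, e.g. `ζ'/ζ(−1/2 + it) = −log(|t| + 2) + O(1)`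
"which follows easily from the functional equation" in Montgomery's explicit formula (Montgomery 1973,
Lemma; Goldston 2005, proof of Proposition 1), via `Γ_ℝ'/Γ_ℝ(s) = −½ log π + ½ ψ(s/2)`.
Everything here is proved; there are no named facts.

## References

* G. E. Andrews, R. Askey, R. Roy, *Special Functions*, CUP 1999, §1.2 (Gauss's formula; Stirling for
  `ψ`, Cor. 1.4.5).
* D. A. Goldston, *Notes on pair correlation of zeros and prime numbers*, LMS Lecture Note Ser. 322
  (2005), proof of Proposition 1.
-/

noncomputable section

open Complex Filter Topology Set
open scoped Real ComplexConjugate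

namespace Literature.Analysis.SpecialFunctions.Complex

/-- **`ψ(a + iy) = log(1 + |y|) + O_a(1)` on a vertical line `Re w = a > 0`** (two-sided form of
`exists_norm_digamma_vertical_le`): from `|Re ψ(w) − log‖w‖| ≤ 1/(2‖w‖²) + π/(4|Im w|)`
(`abs_re_digamma_sub_log_norm_le`), `|Im ψ(w)| ≤ |Im w|/‖w‖² + π/2` (`abs_im_digamma_le`) for
`|y| ≥ 1`, `|y| ≤ ‖w‖ ≤ a + |y|`, and continuity of `ψ` on the compact segment `|y| ≤ 1`. [folklore] -/
theorem exists_norm_digamma_sub_log_le_of_pos {a : ℝ} (ha : 0 < a) :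
    ∃ C : ℝ, ∀ y : ℝ, ‖digamma (a + y * I) - Real.log (1 + |y|)‖ ≤ C := by
  -- compact segment
  set K : Set ℂ := (fun y : ℝ ↦ (a : ℂ) + y * I) '' Icc (-(1 : ℝ)) 1 with hK
  have hKc : IsCompact K := (isCompact_Icc).image (by fun_prop)
  have hKsub : K ⊆ {w : ℂ | 0 < w.re} := by
    rintro _ ⟨y, -, rfl⟩; simpa using ha
  obtain ⟨M, hM⟩ := hKc.exists_bound_of_continuousOn (continuousOn_digamma.mono hKsub)
  refine ⟨max (M + Real.log 2) (1 / 2 + π / 4 + 1 + π / 2 + Real.log (1 + a) + Real.log 2), fun y ↦ ?_⟩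
  rcases le_or_gt 1 |y| with hy | hy
  · -- `|y| ≥ 1`
    set w : ℂ := (a : ℂ) + y * I with hw
    have hwre : w.re = a := by simp [hw]
    have hwim : w.im = y := by simp [hw]
    have hre : 0 < w.re := by rw [hwre]; exact ha
    have hy0 : y ≠ 0 := fun h ↦ by rw [h, abs_zero] at hy; linarith
    have him : w.im ≠ 0 := by rwa [hwim]
    have hnorm_ge : |y| ≤ ‖w‖ := by rw [← hwim]; exact Complex.abs_im_le_norm w
    have hnorm_le : ‖w‖ ≤ a + |y| := by
      rw [hw]
      refine (norm_add_le _ _).trans ?_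
      simp [abs_of_pos ha]
    have hw1 : 1 ≤ ‖w‖ := hy.trans hnorm_ge
    have hwpos : 0 < ‖w‖ := by linarith
    have h1 := abs_re_digamma_sub_log_norm_le hre him
    have h2 := abs_im_digamma_le hre him
    rw [hwim] at h1 h2
    -- the two error terms are bounded
    have e1 : 1 / (2 * ‖w‖ ^ 2) ≤ 1 / 2 := by
      rw [div_le_div_iff₀ (by positivity) (by norm_num)]; nlinarith
    have e2 : π / (4 * |y|) ≤ π / 4 := by
      rw [div_le_div_iff₀ (by positivity) (by norm_num)]; nlinarith [Real.pi_pos]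
    have e3 : |y| / ‖w‖ ^ 2 ≤ 1 := by
      rw [div_le_one (by positivity)]; nlinarith
    -- `log ‖w‖` versus `log (1 + |y|)`
    have hl1 : Real.log |y| ≤ Real.log ‖w‖ := Real.log_le_log (by positivity) hnorm_ge
    have hl2 : Real.log ‖w‖ ≤ Real.log (1 + a) + Real.log |y| := by
      rw [← Real.log_mul (by positivity) (by positivity)]
      refine Real.log_le_log hwpos ?_
      nlinarith
    have hl3 : Real.log |y| ≤ Real.log (1 + |y|) := Real.log_le_log (by positivity) (by linarith)
    have hl4 : Real.log (1 + |y|) ≤ Real.log 2 + Real.log |y| := by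
      rw [← Real.log_mul (by norm_num) (by positivity)]
      refine Real.log_le_log (by positivity) ?_
      linarith
    have hla : 0 ≤ Real.log (1 + a) := Real.log_nonneg (by linarith)
    have hl2' : 0 ≤ Real.log 2 := Real.log_nonneg (by norm_num)
    have hdl : |Real.log ‖w‖ - Real.log (1 + |y|)| ≤ Real.log (1 + a) + Real.log 2 := by
      rw [abs_le]; constructor <;> linarith
    -- combine real and imaginary parts
    have hsplit : ‖digamma w - Real.log (1 + |y|)‖ ≤
        |(digamma w).re - Real.log (1 + |y|)| + |(digamma w).im| := by
      have := Complex.norm_le_abs_re_add_abs_im (digamma w - Real.log (1 + |y|))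
      simpa using this
    have hre' : |(digamma w).re - Real.log (1 + |y|)| ≤
        |(digamma w).re - Real.log ‖w‖| + |Real.log ‖w‖ - Real.log (1 + |y|)| := abs_sub_le _ _ _
    calc ‖digamma (a + y * I) - Real.log (1 + |y|)‖ = ‖digamma w - Real.log (1 + |y|)‖ := by rw [hw]
      _ ≤ 1 / 2 + π / 4 + 1 + π / 2 + Real.log (1 + a) + Real.log 2 := by linarith
      _ ≤ _ := le_max_right _ _
  · -- `|y| < 1`: compactness
    have hyK : (a : ℂ) + y * I ∈ K := ⟨y, ⟨by linarith [(abs_lt.1 hy).1], (abs_lt.1 hy).2.le⟩, rfl⟩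
    have h1 : ‖digamma (a + y * I)‖ ≤ M := hM _ hyK
    have h2 : ‖((Real.log (1 + |y|) : ℝ) : ℂ)‖ ≤ Real.log 2 := by
      rw [Complex.norm_real, Real.norm_of_nonneg (Real.log_nonneg (by linarith [abs_nonneg y]))]
      exact Real.log_le_log (by linarith [abs_nonneg y]) (by linarith)
    calc ‖digamma (a + y * I) - Real.log (1 + |y|)‖ ≤ ‖digamma (a + y * I)‖ + ‖((Real.log (1 + |y|) : ℝ) : ℂ)‖ :=
          norm_sub_le _ _
      _ ≤ M + Real.log 2 := add_le_add h1 h2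
      _ ≤ _ := le_max_left _ _

/-- **`ψ(a + iy) = log(1 + |y|) + O_a(1)` on every vertical line off the poles** (`a ≠ 0, −1, −2, …`):
reduce to `Re w > 0` by `ψ(w) = ψ(w + m) − ∑_{j<m} 1/(w + j)`, each shift term being bounded by
`1/|a + j|`. This is the form of Stirling's formula for `Γ'/Γ` used for secondary terms of explicit
formulas on lines to the left of the critical strip (e.g. `ζ'/ζ(−1/2 + it) = −log|t| + O(1)`,
Montgomery 1973, Lemma; Goldston 2005, proof of Proposition 1). [folklore] -/
theorem exists_norm_digamma_sub_log_le {a : ℝ} (ha : ∀ n : ℕ, a ≠ -n) :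
    ∃ C : ℝ, ∀ y : ℝ, ‖digamma (a + y * I) - Real.log (1 + |y|)‖ ≤ C := by
  -- shift by `m` with `a + m > 0`
  obtain ⟨m, hm⟩ : ∃ m : ℕ, 0 < a + m := by
    obtain ⟨m, hm⟩ := exists_nat_gt (-a)
    exact ⟨m, by linarith⟩
  obtain ⟨C, hC⟩ := exists_norm_digamma_sub_log_le_of_pos hm
  refine ⟨C + ∑ j ∈ Finset.range m, 1 / |a + j|, fun y ↦ ?_⟩
  set w : ℂ := (a : ℂ) + y * I with hw
  have hwk : ∀ k : ℕ, w ≠ -k := by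
    intro k h
    have h1 := congrArg Complex.im h
    have h2 := congrArg Complex.re h
    simp [hw] at h1 h2
    exact ha k (by linarith)
  -- `ψ(w + m) = ψ(w) + ∑_{j<m} 1/(w+j)` (iterate of `Complex.digamma_apply_add_one`)
  have hshift : ∀ n : ℕ, digamma (w + n) = digamma w + ∑ j ∈ Finset.range n, (w + j)⁻¹ := by
    intro n
    induction n with
    | zero => simp
    | succ n ih =>
      have hwn : ∀ k : ℕ, w + n ≠ -k := by
        intro k h
        exact hwk (k + n) (by push_cast; linear_combination h)
      rw [Finset.sum_range_succ, ← add_assoc, ← ih, Nat.cast_succ, ← add_assoc]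
      exact Complex.digamma_apply_add_one (w + n) hwn
  replace hshift := hshift m
  have hwm : w + m = ((a + m : ℝ) : ℂ) + y * I := by simp [hw]; ring
  have e : digamma w = digamma (((a + m : ℝ) : ℂ) + y * I) - ∑ j ∈ Finset.range m, (w + j)⁻¹ := by
    rw [← hwm, hshift]; ring
  have hterm : ∀ j ∈ Finset.range m, ‖(w + j)⁻¹‖ ≤ 1 / |a + j| := by
    intro j _
    have haj : a + j ≠ 0 := by
      intro h; exact ha j (by linarith)
    rw [norm_inv, one_div]
    refine inv_anti₀ (abs_pos.2 haj) ?_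
    have : (w + j).re = a + j := by simp [hw]
    calc |a + j| = |(w + j).re| := by rw [this]
      _ ≤ ‖w + j‖ := Complex.abs_re_le_norm _
  calc ‖digamma (a + y * I) - Real.log (1 + |y|)‖
      = ‖(digamma (((a + m : ℝ) : ℂ) + y * I) - Real.log (1 + |y|)) - ∑ j ∈ Finset.range m, (w + j)⁻¹‖ := by
        rw [← hw, e]; ring_nf
    _ ≤ ‖digamma (((a + m : ℝ) : ℂ) + y * I) - Real.log (1 + |y|)‖ + ‖∑ j ∈ Finset.range m, (w + j)⁻¹‖ :=
        norm_sub_le _ _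
    _ ≤ C + ∑ j ∈ Finset.range m, 1 / |a + j| :=
        add_le_add (hC y) ((norm_sum_le _ _).trans (Finset.sum_le_sum hterm))

end Literature.Analysis.SpecialFunctions.Complex
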